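import Summits.AtomisticToContinuum.Crystallization.Theorems.FrustratedLawDichotomyStrainedPatchHomForceCentredPilot

/-!
# (C′-2) FORCE/EXEMPT PRUNE, centred form — second pilot shard: the CELL OF RECORD `U 2⁻⁹ × ξ 2⁻⁹` (critic row 1067 (B)) at the Finding-A point
# (27623 strained-patch piece, hcp half; decomp-a2c hand-2 g28)

Same centre, direction and step as `…HomForceCentredPilot` (which certifies `ξ`-half-width `2⁻¹⁰`); here the shuffle half-width is `2⁻⁹` too — the
cell size of record of critic row 1067 (B).  The `A`-family certificate is unchanged (`A` does not see `ξ`); the `B`-family certificate has the same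
thin data (`K`, `S`, value) and larger naive/remainder sums; `boundC = −28828976639917 = −0.1024·SC < −0.0108·SC`.  Kernel: two `decide +kernel`
facts (≈ 50 s each).  COMPUTATIONAL module; imports the first pilot only for its literals (`w910`-independent `certA`, `kB`, `sB`); nothing imports it.
0 sorry; axioms standard.  `--supports stmt-AtomisticToContinuum-27623`.
-/

namespace Summit.AtomisticToContinuum.Crystallization.Theorems.FrustratedLawDichotomyStrainedPatchHomForceCentredPilotXi9

open scoped BigOperators RealInnerProductSpace
open Literature.Analysis.ValidatedNumerics.Numerics
open Summit.AtomisticToContinuum.Crystallization.Theorems.ChargedEnergyGapNegative (E3)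
open Summit.AtomisticToContinuum.Crystallization.Theorems.FrustratedLawDichotomyAveragingRuleTightFree (TightNearCap BadNearCap)
open Summit.AtomisticToContinuum.Crystallization.Theorems.FrustratedLawDichotomyExemptAbsorption (ExemptNear)
open Summit.AtomisticToContinuum.Crystallization.Theorems.FrustratedLawDichotomyStrainedPatchHomSplit
open Summit.AtomisticToContinuum.Crystallization.Theorems.FrustratedLawDichotomyStrainedPatchHomForceSum (dirOK slopeTestOK)
open Summit.AtomisticToContinuum.Crystallization.Theorems.FrustratedLawDichotomyStrainedPatchHomForceNestPilot (cFA fa_dir)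
open Summit.AtomisticToContinuum.Crystallization.Theorems.FrustratedLawDichotomyStrainedPatchHomForceCentred
open Summit.AtomisticToContinuum.Crystallization.Theorems.FrustratedLawDichotomyStrainedPatchHomForceCentredFinal (forceOutC_sound_of_parts)
open Summit.AtomisticToContinuum.Crystallization.Theorems.FrustratedLawDichotomyStrainedPatchHomForceCentredPilot (certA kB sB)

/-- Half-widths `2⁻⁹` (scaled `2^39`) in all twelve coordinates. -/
def w99 : (Fin 3 × Fin 3) ⊕ Fin 3 → ℤ := fun _ => 549755813888

/-- `B`-family certificate at `ξ`-half-width `2⁻⁹`: value `−0.1859·SC`, naive `0.0035·SC`, remainder `0.0551·SC` (not yet halved); thin data as in the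
first pilot. -/
def certB99 : FamCert := ⟨-52319398844433, 973585452879, 15496788295021, fun ac => kB ac.1 ac.2, sB⟩

/-- The threshold test on `boundC = −28828976639917 = −0.1024·SC` at `s = 10⁻⁶`. [formal bookkeeping] -/
theorem q_test : slopeTestOK (boundC cFA w99 certA certB99) 1 1000000 = true := by decide

set_option maxRecDepth 100000 in
set_option maxHeartbeats 4000000 in
/-- KERNEL: the `A`-family fold passes `certA` on the `2⁻⁹` cube. [formal bookkeeping] -/
theorem q_checkA : checkA ![982, 177, 55] 1000 1 1000000 cFA w99 certA = true := by
  decide +kernel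

set_option maxRecDepth 100000 in
set_option maxHeartbeats 4000000 in
/-- KERNEL: the `B`-family fold passes `certB99` on the `2⁻⁹` cube. [formal bookkeeping] -/
theorem q_checkB : checkB ![982, 177, 55] 1000 1 1000000 cFA w99 certB99 = true := by
  decide +kernel

/-- ★★★ **THE FINDING-A SHARD ON THE CELL OF RECORD `(2⁻⁹)¹²`**: every `(U, ξ)` of the `2⁻⁹`-cube about the Finding-A point (with `‖U − 1‖ ≤ 1/4`,
`‖ξ‖ ≤ 1/4`) is pruned by `ExemptNear (9/5) ExRec z c`. [folklore] -/
theorem prune_findingA_9_9 (U : E3 →L[ℝ] E3) (ξ : E3) (hU : ‖U - 1‖ ≤ 1 / 4) (hξn : ‖ξ‖ ≤ 1 / 4)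
    (hbox : ∀ ab : Fin 3 × Fin 3, |(U (EuclideanSpace.single ab.2 (1 : ℝ))) ab.1 - (cFA (Sum.inl ab) : ℝ) / SC| ≤ (w99 (Sum.inl ab) : ℝ) / SC)
    (hξ : ∀ i : Fin 3, |ξ i - (cFA (Sum.inr i) : ℝ) / SC| ≤ (w99 (Sum.inr i) : ℝ) / SC) :
    ∀ (M : ℕ) (z : Fin M → E3) (cc : Fin M), Function.Injective z →
      Set.range z = {x : E3 | dist x (z cc) ≤ 133 / 10 ∧ ∃ a : Fin 3 → ℤ,
        x = z cc + latPt U hexFrame a ∨ x = z cc + latPt U hexFrame a + U (hcpShift + ξ)} →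
      TightNearCap (9 / 5) (3 / 2) z cc ∨ ExemptNear (9 / 5) ExRec z cc ∨ BadNearCap (9 / 5) (3 / 2) z cc :=
  forceOutC_sound_of_parts fa_dir (by norm_num) q_checkA q_checkB q_test U ξ hU hξn hbox hξ

end Summit.AtomisticToContinuum.Crystallization.Theorems.FrustratedLawDichotomyStrainedPatchHomForceCentredPilotXi9
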